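import Literature.Computability.Cryptography.RegevReductionStageResiduals
import Literature.Computability.Cryptography.RegevReductionLemma320
import Literature.Computability.QuantumComplexity.CWrapReadLaw
import Literature.Computability.QuantumComplexity.CWrapAssembly
import Literature.Computability.Cryptography.CoinBlockLaws
import Literature.Computability.Cryptography.LWEProductLaws
import Literature.Computability.Complexity.CodeFPRat
import Literature.Computability.Complexity.CodeFPOfUnary
import Literature.Algebra.EuclideanLattices.GapInstanceCodeFP
import HarnessLib

/-!
# Regev 2009, Theorem 3.1 at the machine level: the one-sample stage machine (residual A) assembled
# from Lemma 3.2 (bootstrapping sampler) and Lemma 3.3 (iterative step) — the dispatcher, PROVED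

Topic `Computability/Cryptography` (family `pqc`), sequel of `RegevReductionStageResiduals.lean` (the two
named facts `regev2009_lemma_3_2_sampler` = residual A_boot, `regev2009_lemma_3_3_stepMachine q α` =
residual A_step) and of `RegevReductionResiduals.lean` (residual A =
`regev2009_thm_3_1_oneSampleStage q α`, with the PROVED assemblies to Theorem 3.1 as printed and to
`regev_lwe_to_sivp_quantum` / `regev_lwe_to_gapSVP_quantum`). O. Regev, *On lattices, learning with errors,
random linear codes, and cryptography*, J. ACM 56 (2009), art. 34 (author's version arXiv:2401.03703,
whose page numbers are quoted), proof of Theorem 3.1 (p. 15): the `DGS` sampler "starts by calling the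
procedure of Lemma 3.2" at the radius `r_{3n} = r·(αp/√n)^{3n}` and then applies "the procedure of
Lemma 3.3" `3n` times.

PROVED HERE (no `sorry`, no new axioms):

* `regev2009_thm_3_1_oneSampleStage_of_boot_of_step :
    regev2009_lemma_3_2_sampler → regev2009_lemma_3_3_stepMachine q α → regev2009_thm_3_1_oneSampleStage q α`
  — residual A follows from the two lemma-level residuals. The one-sample stage family `Q` of residual
  A is the DISPATCHER `StageDispatch.Machine.Q`: a uniform coin block of `p_c(G(|input|))` coins
  (`QuantumComplexity.CoinPrefix`) in front of the classical wrap (`QuantumComplexity.CWrap`) of the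
  step family `Q₁` of A_step by the pre-processor `StageDispatch.hPre` (strip the coins:
  `⟨z, e_j ++ c⟩ ↦ ⟨z, e_j⟩`, `|e_j| = p_N(2|z|+2)+1`) and the post-processor `StageDispatch.gSel` (at
  stage `0`: rescale the instance code to `x' = ⟨I, θ(n)^{3n} r⟩` — `StageDispatch.rescale_codeFP`, exact
  rational arithmetic on codes — and emit `boot ⟨x', c ↾ p_c(|x'|)⟩`; at stages `≥ 1`: emit the answer
  of `Q₁` verbatim). Its laws: `Machine.kernel_eq_bind` (the kernel is the uniform mixture of the
  branches, `CoinPrefix.kernel_eq_bind`), `Machine.map_kernel_succ` (at stages `≥ 1` the wrap is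
  transparent for the `DGS` reader, `CWrap.map_kernel_eq_of_read` with clause (CODE⁺) of A_step),
  `Machine.map_kernel_zero` (at stage `0` the decoded output has the law of `boot` on `p_c(|x'|)` uniform
  coins — the branch is deterministic given the coins, and the marginal of a uniform coin block on its
  first `p_c(|x'|)` coins is uniform, `StageDispatch.uniform_map_ofFn_take`), `Machine.exists_of_mem_support`
  (every output extends `g ⟨input ++ c, y'⟩`). Then (CODE) of residual A is FORMAT of A_boot at stage `0`
  and (CODE⁺) of A_step at stages `≥ 1`; (BOOT₁) is LAW of A_boot at the rational radius
  `θ(n)^{3n} r = levelRadius θ (3n) r 0`; (STEP₁), (PASS₁) are those of A_step verbatim; the negligible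
  function is `|ν_boot| + |ν₁|`, the ratio the cast of A_step's rational `θ`, the code polynomial A_step's
  `L ≥ L_b ∘ G` (`G` a length bound of the rescaling map, `exists_poly_length_le_of_mem_FP`).
* Consequences by the proved assemblies: `regev2009_thm_3_1_dgs_of_boot_of_step` (Theorem 3.1 as
  printed), `regev_lwe_to_sivp_quantum_holds_of_boot_of_step` (`pqc.S19`, with the proved Lemma 3.17),
  `regev_lwe_to_gapSVP_quantum_holds_of_boot_of_step` (with the proved Lemma 3.20 machine
  `regev2009_lemma_3_20_machine_holds`).

RESIDUAL HYPOTHESES after this file (named facts, stated in `RegevReductionStageResiduals.lean`):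
A_boot = Lemma 3.2 as a classical poly-time program with explicit coins (LLL + rounding; its LAW is the
content of `RegevBootstrap.lean` at the function level, the missing piece is the `FP` machine with a
polynomial-precision Gaussian sampler), A_step = Lemma 3.3 = Lemma 3.4 (classical, with the `LWE`
oracle) + Lemma 3.14 (quantum) as ONE uniform family on one sample. Value = a machine-checked
dispatcher theorem and two typed residuals replacing one — NOT a proof of Theorem 3.1's remaining
analytic/algorithmic content.

## Faithfulness notes

* The dispatcher is the only new machine; it uses no oracle and no quantum gate beyond the coin
  block's Hadamards (`CoinPrefix`) and the reversible classical pre/post-processing of `CWrap` around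
  `Q₁` — exactly "classical computation inside a quantum machine" (Bernstein–Vazirani 1997, §8).
* Stage `0` ignores the copy index and the (empty) batch: every copy runs `boot` on its own coins, as
  the `p_N(n)` initial samples of the printed proof are independent calls of Lemma 3.2's procedure.
* The rescaled radius is computed EXACTLY in `ℚ` (`θ ∈ ℚ` poly-time computable in unary `n`, powers by
  a unary exponent: `StageDispatch.ratPowUn`), so (BOOT₁)'s radius `levelRadius θ (3n) r 0 = θ^{3n} r`
  is hit on the nose (`Rat.cast_mul`, `Rat.cast_pow`).

## References

* O. Regev, *On lattices, learning with errors, random linear codes, and cryptography*, J. ACM 56 (2009),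
  art. 34; author's version arXiv:2401.03703: Theorem 3.1 (proof, p. 15), Lemmas 3.2, 3.3 (p. 15).
  [Regev2009] [RegevLWE2009]
* E. Bernstein, U. Vazirani, *Quantum complexity theory*, SIAM J. Comput. 26 (1997), §8 (classical
  computation inside quantum machines; coins by Hadamard gates, Thm. 8.3). [BernsteinVazirani1997]
-/

noncomputable section

namespace Literature.Computability.Cryptography

open Filter _root_.Computability Literature.Computability.Complexity Literature.Computability.Cryptography.LWE
  Literature.Algebra.EuclideanLattices Literature.Computability.QuantumComplexity

namespace Regev2009

namespace StageDispatch

open Polynomial Brick Plumb StageCopies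

/-! ### Strings: framed codes, coins -/

/-- The `DGS` reader reads `v` off every string starting with the framed code `⟨vecCode n v, ε⟩`.
[folklore] -/
theorem decode_of_prefix {n : ℕ} {v : Fin n → ℤ} {s : List Bool} (h : boolPair (vecCode n v) [] <+: s) :
    decodeLatticeVector n s = v := by
  obtain ⟨t, rfl⟩ := h
  rw [boolPair_append, List.nil_append, vecCode, decodeLatticeVector_boolPair]

/-- **Marginal of a uniform coin block**: a function of the first `m` of `M ≥ m` uniform coins has the
law of the same function of `m` uniform coins. [folklore] -/
theorem uniform_map_ofFn_take {β : Type} (m M : ℕ) (h : m ≤ M) (f : List Bool → β) :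
    (PMF.uniformOfFintype (QReg M)).map (fun c => f ((List.ofFn c).take m)) =
      (PMF.uniformOfFintype (QReg m)).map (fun c => f (List.ofFn c)) := by
  obtain ⟨d, rfl⟩ := Nat.exists_eq_add_of_le h
  rw [← PMF.uniformOfFintype_map_equiv (Fin.appendEquiv m d), PMF.map_comp]
  have hf : (fun c : QReg (m + d) => f ((List.ofFn c).take m)) ∘ (Fin.appendEquiv m d) =
      (fun c : QReg m => f (List.ofFn c)) ∘ Prod.fst := by
    funext p
    show f ((List.ofFn (Fin.append p.1 p.2)).take m) = f (List.ofFn p.1)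
    rw [List.ofFn_fin_append, List.take_left' List.length_ofFn]
  rw [hf, ← PMF.map_comp, LWE.uniformOfFintype_map_fst]

/-! ### The rescaling map `⟨I, r⟩ ↦ ⟨I, θ(n)^{3n} r⟩` is computed on codes -/

/-- Exact rational powers with a unary exponent, on codes. [folklore] -/
theorem ratPowUn : CodeFP (CodeFP.pairE encodeRat CodeFP.unE) encodeRat (fun p : ℚ × ℕ => p.1 ^ p.2) := by
  have hnd : CodeFP (CodeFP.pairE encodeRat CodeFP.unE) (CodeFP.pairE CodeFP.intE CodeFP.natE)
      (fun p : ℚ × ℕ => (p.1.num, p.1.den)) :=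
    (CodeFP.ratNumDen.comp (CodeFP.fst encodeRat CodeFP.unE) :)
  have he : CodeFP (CodeFP.pairE encodeRat CodeFP.unE) CodeFP.unE (fun p : ℚ × ℕ => p.2) :=
    CodeFP.snd encodeRat CodeFP.unE
  have hnum : CodeFP (CodeFP.pairE encodeRat CodeFP.unE) CodeFP.intE (fun p : ℚ × ℕ => p.1.num ^ p.2) :=
    (CodeFP.intPow.comp (hnd.fst'.pair he) :)
  have hden : CodeFP (CodeFP.pairE encodeRat CodeFP.unE) CodeFP.natE (fun p : ℚ × ℕ => p.1.den ^ p.2) :=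
    (CodeFP.natPow.comp (hnd.snd'.pair he) :)
  refine (CodeFP.ratOfIntNat.comp (hnum.pair hden)).congr fun p => ?_
  show ((p.1.num ^ p.2 : ℤ) : ℚ) / ((p.1.den ^ p.2 : ℕ) : ℚ) = p.1 ^ p.2
  rw [Int.cast_pow, Nat.cast_pow, ← div_pow, Rat.num_div_den]

/-- **The rescaled instance code** `⟨I, r⟩ ↦ ⟨I, θ(n)^{3n}·r⟩ (`n = dim I`) is computed on codes, for a
poly-time computable rational `θ`. [cite: Regev2009, proof of Theorem 3.1 (p. 15): `r_i = r (αp/√n)^i`] -/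
theorem rescale_codeFP {θ : ℕ → ℚ} (hθ : PolyTimeComputable unaryEncodeNat encodeRat θ) :
    CodeFP GapSVPInstance.encode GapSVPInstance.encode
      (fun p : GapSVPInstance => (p.1, θ p.1.n ^ (3 * p.1.n) * p.2)) := by
  have hθ' : CodeFP CodeFP.unE encodeRat θ := CodeFP.ofPolyTimeComputable_unE hθ
  have hn : CodeFP GapSVPInstance.encode CodeFP.unE (fun p : GapSVPInstance => p.1.n) := GapCodes.svpNUn_codeFP
  have h3n : CodeFP GapSVPInstance.encode CodeFP.unE (fun p : GapSVPInstance => 3 * p.1.n) :=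
    (CodeFP.unAdd.comp (hn.pair (CodeFP.unAdd.comp (hn.pair hn)))).congr fun p => by
      show p.1.n + (p.1.n + p.1.n) = 3 * p.1.n
      ring
  have hθn : CodeFP GapSVPInstance.encode encodeRat (fun p : GapSVPInstance => θ p.1.n) := (hθ'.comp hn :)
  have hpow : CodeFP GapSVPInstance.encode encodeRat (fun p : GapSVPInstance => θ p.1.n ^ (3 * p.1.n)) :=
    (ratPowUn.comp (hθn.pair h3n) :)
  have hr : CodeFP GapSVPInstance.encode encodeRat (fun p : GapSVPInstance => p.2) :=
    ⟨sndF, sndF_mem_FP, fun p => sndF_boolPair _ _⟩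
  have hI : CodeFP GapSVPInstance.encode LatticeInstance.encode (fun p : GapSVPInstance => p.1) :=
    ⟨fstF, fstF_mem_FP, fun p => fstF_boolPair _ _⟩
  have hρ : CodeFP GapSVPInstance.encode encodeRat
      (fun p : GapSVPInstance => θ p.1.n ^ (3 * p.1.n) * p.2) :=
    (CodeFP.ratMul.comp (hpow.pair hr) :)
  exact (hI.pair hρ).recodeOut fun p => rfl

/-! ### The bricks of the dispatcher -/

section Bricks

variable (boot rad : List Bool → List Bool) (pcB pN : Polynomial ℕ)

/-- The copy-count polynomial in the stage-input length: `K'(t) = p_N(2t+2) + 1`, so that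
`KOf p_N x k y = K'(|stageInput x k y|)`. [folklore] -/
def KPoly : Polynomial ℕ := pN.comp (2 * X + 2) + 1

/-- `K'(t) = p_N(2t+2) + 1`. [folklore] -/
@[simp] theorem eval_KPoly (t : ℕ) : (KPoly pN).eval t = pN.eval (2 * t + 2) + 1 := by
  simp [KPoly]

/-- `KOf p_N x k y = K'(|stageInput x k y|)`. [folklore] -/
theorem KOf_eq (x : List Bool) (k : ℕ) (y : List Bool) :
    KOf pN x k y = (KPoly pN).eval (stageInput x k y).length := by
  rw [eval_KPoly]; rfl

/-- `|e_j| = K`. [folklore] -/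
theorem length_idxWord (K j : ℕ) : (idxWord K j).length = K := List.length_ofFn

/-- **Pre-processor** (strip the coins): `⟨z, s⟩ ↦ ⟨z, s ↾ K'(|z|)⟩`. [folklore] -/
def hPre : List Bool → List Bool :=
  fanoutFn fstF (takeFn ∘ fanoutFn (polyFn (KPoly pN) ∘ fstF) sndF)

/-- `hPre ∈ FP`. [folklore] -/
theorem hPre_mem_FP : hPre pN ∈ FP :=
  fanoutFn_mem_FP fstF_mem_FP (comp_mem_FP takeFn_mem_FP
    (fanoutFn_mem_FP (comp_mem_FP (polyFn_mem_FP _) fstF_mem_FP) sndF_mem_FP))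

/-- `hPre ⟨z, e ++ c⟩ = ⟨z, e⟩` when `|e| = K'(|z|)`. [folklore] -/
theorem hPre_apply (z e c : List Bool) (he : e.length = (KPoly pN).eval z.length) :
    hPre pN (boolPair z (e ++ c)) = boolPair z e := by
  simp only [hPre, fanoutFn_apply, Function.comp_apply, fstF_boolPair, sndF_boolPair, takeFn_boolPair,
    polyFn_apply, List.length_replicate]
  rw [← he, List.take_left' rfl]

/-- The branch condition `[k = 0]` of a context. [folklore] -/
def condC : List Bool → List Bool := isNilFn ∘ fstF ∘ sndF ∘ StagePost.xC

/-- The coins `c` of a context `⟨⟨z, e ++ c⟩, Y⟩`, `|e| = K'(|z|)`. [folklore] -/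
def coinsC : List Bool → List Bool :=
  dropFn ∘ fanoutFn (polyFn (KPoly pN) ∘ StagePost.xC) (sndF ∘ fstF)

/-- The rescaled instance code `x' = rad x` of a context. [folklore] -/
def radC : List Bool → List Bool := rad ∘ fstF ∘ StagePost.xC

/-- The first `p_c(|x'|)` coins of a context. [folklore] -/
def coinsB : List Bool → List Bool :=
  takeFn ∘ fanoutFn (polyFn pcB ∘ radC rad) (coinsC pN)

/-- The stage-`0` output `boot ⟨x', c'⟩` of a context. [folklore] -/
def bootC : List Bool → List Bool :=
  boot ∘ fanoutFn (radC rad) (coinsB rad pcB pN)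

/-- **Post-processor**: at stage `0` the bootstrapping sampler's output, at stages `≥ 1` the measured
answer `Y` of the step machine verbatim. [folklore] -/
def gSel : List Bool → List Bool := iteFn condC (bootC boot rad pcB pN) sndF

/-- `condC ∈ FP`. [folklore] -/
theorem condC_mem_FP : condC ∈ FP :=
  comp_mem_FP isNilFn_mem_FP (comp_mem_FP fstF_mem_FP (comp_mem_FP sndF_mem_FP StagePost.xC_mem_FP))

/-- `coinsC ∈ FP`. [folklore] -/
theorem coinsC_mem_FP : coinsC pN ∈ FP :=
  comp_mem_FP dropFn_mem_FP (fanoutFn_mem_FP (comp_mem_FP (polyFn_mem_FP _) StagePost.xC_mem_FP)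
    (comp_mem_FP sndF_mem_FP fstF_mem_FP))

variable {boot rad}

/-- `radC ∈ FP` for `rad ∈ FP`. [folklore] -/
theorem radC_mem_FP (hrad : rad ∈ FP) : radC rad ∈ FP :=
  comp_mem_FP hrad (comp_mem_FP fstF_mem_FP StagePost.xC_mem_FP)

/-- `coinsB ∈ FP` for `rad ∈ FP`. [folklore] -/
theorem coinsB_mem_FP (hrad : rad ∈ FP) : coinsB rad pcB pN ∈ FP :=
  comp_mem_FP takeFn_mem_FP (fanoutFn_mem_FP (comp_mem_FP (polyFn_mem_FP _) (radC_mem_FP hrad))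
    (coinsC_mem_FP pN))

/-- `bootC ∈ FP` for `boot, rad ∈ FP`. [folklore] -/
theorem bootC_mem_FP (hboot : boot ∈ FP) (hrad : rad ∈ FP) : bootC boot rad pcB pN ∈ FP :=
  comp_mem_FP hboot (fanoutFn_mem_FP (radC_mem_FP hrad) (coinsB_mem_FP pcB pN hrad))

/-- **The post-processor is polynomial-time** (`boot, rad ∈ FP`). [folklore] -/
theorem gSel_mem_FP (hboot : boot ∈ FP) (hrad : rad ∈ FP) : gSel boot rad pcB pN ∈ FP :=
  iteFn_mem_FP condC_mem_FP (bootC_mem_FP pcB pN hboot hrad) sndF_mem_FP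

variable (boot rad)

/-! Values on a context `⟨⟨stageInput x k y, e ++ c⟩, Y⟩`. -/

/-- At stage `0` the branch condition is `[true]`. [folklore] -/
theorem condC_ctx_zero (x : List Bool) (y s Y : List Bool) :
    condC (boolPair (boolPair (stageInput x 0 y) s) Y) = [true] := by
  simp [condC, StagePost.xC, stageInput, isNilFn]

/-- At stages `≥ 1` the branch condition is `[false]`. [folklore] -/
theorem condC_ctx_succ (x : List Bool) (k : ℕ) (y s Y : List Bool) :
    condC (boolPair (boolPair (stageInput x (k + 1) y) s) Y) = [false] := by
  simp [condC, StagePost.xC, stageInput, isNilFn, List.replicate_succ]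

/-- `coinsC` reads the coins. [folklore] -/
theorem coinsC_ctx (x : List Bool) (k : ℕ) (y e c Y : List Bool)
    (he : e.length = (KPoly pN).eval (stageInput x k y).length) :
    coinsC pN (boolPair (boolPair (stageInput x k y) (e ++ c)) Y) = c := by
  simp only [coinsC, StagePost.xC, Function.comp_apply, fanoutFn_apply, fstF_boolPair, sndF_boolPair,
    dropFn_boolPair, polyFn_apply, List.length_replicate]
  rw [← he, List.drop_left]

/-- `radC` computes the rescaled code `rad x`. [folklore] -/
theorem radC_ctx (x : List Bool) (k : ℕ) (y s Y : List Bool) :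
    radC rad (boolPair (boolPair (stageInput x k y) s) Y) = rad x := by
  simp only [radC, StagePost.xC, Function.comp_apply, fstF_boolPair, stageInput]

/-- `coinsB` reads the first `p_c(|rad x|)` coins. [folklore] -/
theorem coinsB_ctx (x : List Bool) (k : ℕ) (y e c Y : List Bool)
    (he : e.length = (KPoly pN).eval (stageInput x k y).length) :
    coinsB rad pcB pN (boolPair (boolPair (stageInput x k y) (e ++ c)) Y) =
      c.take (pcB.eval (rad x).length) := by
  simp only [coinsB, Function.comp_apply, fanoutFn_apply, radC_ctx, coinsC_ctx pN x k y e c Y he,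
    takeFn_boolPair, polyFn_apply, List.length_replicate]

/-- `bootC` computes `boot ⟨rad x, c ↾ p_c(|rad x|)⟩`. [folklore] -/
theorem bootC_ctx (x : List Bool) (k : ℕ) (y e c Y : List Bool)
    (he : e.length = (KPoly pN).eval (stageInput x k y).length) :
    bootC boot rad pcB pN (boolPair (boolPair (stageInput x k y) (e ++ c)) Y) =
      boot (boolPair (rad x) (c.take (pcB.eval (rad x).length))) := by
  simp only [bootC, Function.comp_apply, fanoutFn_apply, radC_ctx, coinsB_ctx rad pcB pN x k y e c Y he]

/-- **At stage `0` the post-processor emits the bootstrapping sampler's output** on the rescaled code and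
the first `p_c(|x'|)` coins. [folklore] -/
theorem gSel_ctx_zero (x : List Bool) (y e c Y : List Bool)
    (he : e.length = (KPoly pN).eval (stageInput x 0 y).length) :
    gSel boot rad pcB pN (boolPair (boolPair (stageInput x 0 y) (e ++ c)) Y) =
      boot (boolPair (rad x) (c.take (pcB.eval (rad x).length))) := by
  rw [gSel, iteFn_apply_true (condC_ctx_zero x y _ Y), bootC_ctx boot rad pcB pN x 0 y e c Y he]

/-- **At stages `≥ 1` the post-processor emits the step machine's answer verbatim.** [folklore] -/
theorem gSel_ctx_succ (x : List Bool) (k : ℕ) (y s Y : List Bool) :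
    gSel boot rad pcB pN (boolPair (boolPair (stageInput x (k + 1) y) s) Y) = Y := by
  rw [gSel, iteFn_apply_false (condC_ctx_succ x k y s Y), sndF_boolPair]

end Bricks

/-! ### The dispatcher machine -/

/-- **The dispatcher's data** (a hypothesis structure, cf. `StageCopies.Machine`): the classical wrap
(`QuantumComplexity.CWrap`) of the step family `Q₁` by the pre-processor `hPre` and the post-processor
`gSel`, to be run behind a uniform coin block of `p_c(|input|)` coins (`QuantumComplexity.CoinPrefix`).
[cite: BernsteinVazirani1997, §8 (classical computation inside quantum machines)] -/
structure Machine (boot rad : List Bool → List Bool) (pcB : Polynomial ℕ) (Q₁ : UniformQCircuitFamily)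
    (pN pc : Polynomial ℕ) where
  /-- the parameters of the wrapped family -/
  Pin : CWrap.Params
  hh : Pin.h = hPre pN
  hg : Pin.g = gSel boot rad pcB pN
  hF : Pin.F = Q₁.family

/-- The dispatcher's data exist (machines of `hPre`, `gSel`). [cite: BernsteinVazirani1997, §8] -/
theorem nonempty_machine {boot rad : List Bool → List Bool} (hboot : boot ∈ FP) (hrad : rad ∈ FP)
    (pcB : Polynomial ℕ) (Q₁ : UniformQCircuitFamily) (pN pc : Polynomial ℕ) :
    Nonempty (Machine boot rad pcB Q₁ pN pc) := by
  obtain ⟨P, hh, hg, hF⟩ := CWrap.exists_params (hPre_mem_FP pN) (gSel_mem_FP pcB pN hboot hrad) Q₁.isUniform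
  exact ⟨⟨P, hh, hg, hF⟩⟩

namespace Machine

variable {boot rad : List Bool → List Bool} {pcB : Polynomial ℕ} {Q₁ : UniformQCircuitFamily}
  {pN pc : Polynomial ℕ} (M : Machine boot rad pcB Q₁ pN pc)

/-- The coin-prefix parameters: the wrapped family behind `p_c(|input|)` uniform coins. [folklore] -/
abbrev Pc : CoinPrefix.Params := ⟨CWrap.family M.Pin, pc⟩

/-- The wrapped family is uniform. [cite: BernsteinVazirani1997, §8] -/
theorem inner_isUniform : (CWrap.family M.Pin).IsUniform :=
  CWrap.family_isUniform M.Pin (by rw [M.hF]; exact Q₁.isUniform)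

/-- The wrapped family is oracle-free. [cite: BernsteinVazirani1997, §8] -/
theorem inner_isOracleFree : (CWrap.family M.Pin).IsOracleFree :=
  CWrap.family_isOracleFree M.Pin (by rw [M.hF]; exact Q₁.isOracleFree)

/-- **The one-sample stage family `Q`** of residual A: coins, then the classical dispatch around the
step family. [cite: Regev2009, proof of Theorem 3.1 (p. 15); BernsteinVazirani1997, §8] -/
def Q : UniformQCircuitFamily where
  family := CoinPrefix.family M.Pc
  isOracleFree := CoinPrefix.family_isOracleFree M.Pc M.inner_isOracleFree
  isUniform := CoinPrefix.family_isUniform M.Pc M.inner_isUniform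

/-- The kernel of `Q` is the uniform mixture over the coin block of the wrapped family's kernels.
[cite: BernsteinVazirani1997, Thm. 8.3] -/
theorem kernel_eq_bind (v : List Bool) :
    M.Q.kernel v = (PMF.uniformOfFintype (QReg (pc.eval v.length))).bind
      fun c => (CWrap.family M.Pin).kernel 0 (v ++ List.ofFn c) :=
  CoinPrefix.kernel_eq_bind M.Pc (CWrap.inputRecoverable M.Pin) v

/-- Every possible output of `Q` on `v` extends `g ⟨v ++ c, y'⟩` for some coin string `c` and some
possible answer `y'` of `Q₁` on `h (v ++ c)`. [folklore] -/
theorem exists_of_mem_support (v : List Bool) {s : List Bool} (hs : s ∈ (M.Q.kernel v).support) :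
    ∃ c : QReg (pc.eval v.length), ∃ y' ∈ (Q₁.family.kernel 0 (M.Pin.h (v ++ List.ofFn c))).support,
      M.Pin.g (boolPair (v ++ List.ofFn c) y') <+: s := by
  have h := CoinPrefix.support_kernel_subset M.Pc (CWrap.inputRecoverable M.Pin) v hs
  rw [Set.mem_iUnion] at h
  obtain ⟨c, hc⟩ := h
  obtain ⟨y', hy', hpre⟩ := CWrap.support_kernel_subset M.Pin _ hc
  rw [M.hF] at hy'
  exact ⟨c, y', hy', hpre⟩

/-- **Branch law at a stage `≥ 1`**: the wrap is transparent for the `DGS` reader (the answer `y'`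
of `Q₁` is emitted verbatim and starts with the framed code of the vector read off it). [folklore] -/
theorem inner_map_succ (x : List Bool) (k : ℕ) (y : List Bool) (j : ℕ) (c : List Bool) (n : ℕ)
    (hcode : ∀ s ∈ (Q₁.kernel (boolPair (stageInput x (k + 1) y) (idxWord (KOf pN x (k + 1) y) j))).support,
      boolPair (vecCode n (decodeLatticeVector n s)) [] <+: s) :
    ((CWrap.family M.Pin).kernel 0
        (boolPair (stageInput x (k + 1) y) (idxWord (KOf pN x (k + 1) y) j) ++ c)).map (decodeLatticeVector n) =
      (Q₁.kernel (boolPair (stageInput x (k + 1) y) (idxWord (KOf pN x (k + 1) y) j))).map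
        (decodeLatticeVector n) := by
  have he : (idxWord (KOf pN x (k + 1) y) j).length = (KPoly pN).eval (stageInput x (k + 1) y).length := by
    rw [length_idxWord, KOf_eq]
  have hh : M.Pin.h (boolPair (stageInput x (k + 1) y) (idxWord (KOf pN x (k + 1) y) j) ++ c) =
      boolPair (stageInput x (k + 1) y) (idxWord (KOf pN x (k + 1) y) j) := by
    rw [boolPair_append, M.hh, hPre_apply pN _ _ c he]
  have hlaw := CWrap.map_kernel_eq_of_read M.Pin
    (boolPair (stageInput x (k + 1) y) (idxWord (KOf pN x (k + 1) y) j) ++ c)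
    (decodeLatticeVector n) (decodeLatticeVector n) fun y' hy' w hw => by
      rw [hh, M.hF] at hy'
      rw [boolPair_append, M.hg, gSel_ctx_succ] at hw
      exact decode_of_prefix ((hcode y' hy').trans hw)
  rw [hlaw, hh, M.hF]
  rfl

/-- **Branch law at stage `0`**: the output decodes, deterministically, to the vector coded by the
bootstrapping sampler's output on the rescaled code and the first `p_c(|x'|)` coins. [folklore] -/
theorem inner_map_zero (x y : List Bool) (j : ℕ) (c : List Bool) (n : ℕ)
    (hfmt : ∃ v : Fin n → ℤ,
      boot (boolPair (rad x) (c.take (pcB.eval (rad x).length))) = boolPair (vecCode n v) []) :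
    ((CWrap.family M.Pin).kernel 0
        (boolPair (stageInput x 0 y) (idxWord (KOf pN x 0 y) j) ++ c)).map (decodeLatticeVector n) =
      PMF.pure (decodeLatticeVector n (boot (boolPair (rad x) (c.take (pcB.eval (rad x).length))))) := by
  obtain ⟨v, hv⟩ := hfmt
  have he : (idxWord (KOf pN x 0 y) j).length = (KPoly pN).eval (stageInput x 0 y).length := by
    rw [length_idxWord, KOf_eq]
  have hlaw := CWrap.map_kernel_eq_of_read M.Pin
    (boolPair (stageInput x 0 y) (idxWord (KOf pN x 0 y) j) ++ c) (decodeLatticeVector n)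
    (fun _ => decodeLatticeVector n (boot (boolPair (rad x) (c.take (pcB.eval (rad x).length)))))
    fun y' _ w hw => by
      rw [boolPair_append, M.hg, gSel_ctx_zero boot rad pcB pN x y _ c y' he] at hw
      rw [hv] at hw ⊢
      rw [decode_of_prefix hw, vecCode, decodeLatticeVector_boolPair]
  rw [hlaw]
  exact PMF.map_const _ _

/-- **Law of `Q` at a stage `≥ 1`** = the law of the step family (the coins are discarded). [folklore] -/
theorem map_kernel_succ (x : List Bool) (k : ℕ) (y : List Bool) (j n : ℕ)
    (hcode : ∀ s ∈ (Q₁.kernel (boolPair (stageInput x (k + 1) y) (idxWord (KOf pN x (k + 1) y) j))).support,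
      boolPair (vecCode n (decodeLatticeVector n s)) [] <+: s) :
    (M.Q.kernel (boolPair (stageInput x (k + 1) y) (idxWord (KOf pN x (k + 1) y) j))).map (decodeLatticeVector n) =
      (Q₁.kernel (boolPair (stageInput x (k + 1) y) (idxWord (KOf pN x (k + 1) y) j))).map
        (decodeLatticeVector n) := by
  rw [kernel_eq_bind, PMF.map_bind]
  have hb : (fun c : QReg (pc.eval (boolPair (stageInput x (k + 1) y) (idxWord (KOf pN x (k + 1) y) j)).length) =>
      ((CWrap.family M.Pin).kernel 0
        (boolPair (stageInput x (k + 1) y) (idxWord (KOf pN x (k + 1) y) j) ++ List.ofFn c)).map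
          (decodeLatticeVector n)) =
      fun _ => (Q₁.kernel (boolPair (stageInput x (k + 1) y) (idxWord (KOf pN x (k + 1) y) j))).map
        (decodeLatticeVector n) := by
    funext c
    exact M.inner_map_succ x k y j (List.ofFn c) n hcode
  rw [hb]
  exact PMF.bind_const _ _

/-- **Law of `Q` at stage `0`** = the law of the bootstrapping sampler on the rescaled code `x' = rad x`
and `p_c(|x'|)` uniform coins (the marginal of the coin block). [folklore] -/
theorem map_kernel_zero (x y : List Bool) (j n : ℕ) (x' : List Bool) (hx' : rad x = x')
    (hfmt : ∀ c' : List Bool, ∃ v : Fin n → ℤ, boot (boolPair x' c') = boolPair (vecCode n v) [])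
    (hm : pcB.eval x'.length ≤ pc.eval (boolPair (stageInput x 0 y) (idxWord (KOf pN x 0 y) j)).length) :
    (M.Q.kernel (boolPair (stageInput x 0 y) (idxWord (KOf pN x 0 y) j))).map (decodeLatticeVector n) =
      (PMF.uniformOfFintype (QReg (pcB.eval x'.length))).map
        fun c' => decodeLatticeVector n (boot (boolPair x' (List.ofFn c'))) := by
  subst hx'
  rw [kernel_eq_bind, PMF.map_bind]
  have hb : (fun c : QReg (pc.eval (boolPair (stageInput x 0 y) (idxWord (KOf pN x 0 y) j)).length) =>
      ((CWrap.family M.Pin).kernel 0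
        (boolPair (stageInput x 0 y) (idxWord (KOf pN x 0 y) j) ++ List.ofFn c)).map (decodeLatticeVector n)) =
      PMF.pure ∘ fun c => decodeLatticeVector n
        (boot (boolPair (rad x) ((List.ofFn c).take (pcB.eval (rad x).length)))) := by
    funext c
    exact M.inner_map_zero x y j (List.ofFn c) n (hfmt _)
  rw [hb, PMF.bind_pure_comp]
  exact uniform_map_ofFn_take _ _ hm fun c' => decodeLatticeVector n (boot (boolPair (rad x) c'))

end Machine

end StageDispatch

end Regev2009

/-! ### The dispatcher theorem: residual A from Lemma 3.2 and Lemma 3.3 in machine form -/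

section Dispatcher

variable (q : ℕ → ℕ) [∀ n, NeZero (q n)] (α : ℕ → ℝ)

open Polynomial Regev2009 Regev2009.StageCopies Regev2009.StageDispatch

/-- **Residual A from residuals A_boot and A_step** (Regev 2009, proof of Theorem 3.1, p. 15: "the
procedure … starts by calling the procedure of Lemma 3.2 … then repeatedly applies Lemma 3.3"): the
one-sample stage family of `regev2009_thm_3_1_oneSampleStage` is the DISPATCHER that, on a uniform
coin block, at stage `0` rescales the radius to `ρ₀ = θ(n)^{3n} r` and runs the bootstrapping sampler
of Lemma 3.2 on the coins, and at stages `≥ 1` runs the step machine of Lemma 3.3 and emits its answer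
(one uniform family: `QuantumComplexity.CoinPrefix` over `QuantumComplexity.CWrap`; its laws by
`CoinPrefix.kernel_eq_bind` and `CWrap.map_kernel_eq_of_read`, the coin marginal by
`StageDispatch.uniform_map_ofFn_take`). [cite: Regev2009, Theorem 3.1 (proof, p. 15), Lemmas 3.2, 3.3;
BernsteinVazirani1997, §8] -/
theorem regev2009_thm_3_1_oneSampleStage_of_boot_of_step (hB : regev2009_lemma_3_2_sampler)
    (hS : regev2009_lemma_3_3_stepMachine q α) : regev2009_thm_3_1_oneSampleStage q α := by
  intro m hm hP hreg hW ε hε hεpos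
  obtain ⟨boot, pcB, Lb, νB, hbootFP, hνB, hfmt, hlawB⟩ := hB
  obtain ⟨θ, hθ, hθge, hstep⟩ := hS m hm hP hreg hW ε hε hεpos
  obtain ⟨rad, hradFP, hrad⟩ := rescale_codeFP hθ
  obtain ⟨G, hG⟩ := exists_poly_length_le_of_mem_FP hradFP
  obtain ⟨Q₁, pN, L, ν₁, hν₁, hpN, hLreq, hlawS⟩ := hstep (Lb.comp G)
  obtain ⟨M⟩ := nonempty_machine hbootFP hradFP pcB Q₁ pN (pcB.comp G)
  have hnegB : IsNegligible fun n => |νB n| :=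
    Asymptotics.SuperpolynomialDecay.trans_abs_le hνB fun n => by rw [abs_abs]
  have hneg₁ : IsNegligible fun n => |ν₁ n| :=
    Asymptotics.SuperpolynomialDecay.trans_abs_le hν₁ fun n => by rw [abs_abs]
  refine ⟨M.Q, pN, L, fun n => |νB n| + |ν₁ n|, fun n => (θ n : ℝ), hnegB.add hneg₁, hpN, hθge, ?_⟩
  filter_upwards [hlawB, hlawS] with n hBn hSn I r x hIn hI hx
  obtain ⟨hcodeS, hstepS, hpassS⟩ := hSn I r x hIn hI hx
  -- the rescaled code
  have hradx : rad x = GapSVPInstance.encode (I, θ I.n ^ (3 * I.n) * r) := by rw [hx, hrad]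
  have hρ₀ : levelRadius (θ I.n : ℝ) (3 * I.n) r 0 = ((θ I.n ^ (3 * I.n) * r : ℚ) : ℝ) := by
    rw [levelRadius, Nat.sub_zero, Rat.cast_mul, Rat.cast_pow]
  have hLb : Lb.eval (rad x).length ≤ L.eval x.length :=
    (TM2Iter.eval_mono Lb (hG x)).trans (by rw [← eval_comp]; exact hLreq _)
  refine ⟨?_, ?_, ?_, ?_⟩
  · -- (CODE)
    unfold Regev2009.StageCopies.Code
    rw [← hx]
    intro k y j s hs
    obtain ⟨c, y', hy', hpre⟩ := M.exists_of_mem_support _ hs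
    have he : (idxWord (KOf pN x k y) j).length = (KPoly pN).eval (stageInput x k y).length := by
      rw [length_idxWord, KOf_eq]
    rw [boolPair_append] at hy' hpre
    rw [M.hh, hPre_apply pN _ _ _ he] at hy'
    rw [M.hg] at hpre
    cases k with
    | zero =>
      rw [gSel_ctx_zero boot rad pcB pN x y _ _ y' he, hradx] at hpre
      obtain ⟨v, hv, hvlen⟩ := hfmt I (θ I.n ^ (3 * I.n) * r)
        ((List.ofFn c).take (pcB.eval (GapSVPInstance.encode (I, θ I.n ^ (3 * I.n) * r)).length))
      rw [hv] at hpre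
      rw [decode_of_prefix hpre]
      refine ⟨hpre, hvlen.trans ?_⟩
      rw [← hradx]
      exact hLb
    | succ k =>
      rw [gSel_ctx_succ] at hpre
      obtain ⟨hp', hlen'⟩ := hcodeS k y j y' hy'
      rw [decode_of_prefix (hp'.trans hpre)]
      exact ⟨hp'.trans hpre, hlen'⟩
  · -- (BOOT₁)
    intro hρ j hj
    have hm : pcB.eval (GapSVPInstance.encode (I, θ I.n ^ (3 * I.n) * r)).length ≤
        (pcB.comp G).eval (boolPair (stageInput x 0 []) (idxWord (KOf pN x 0 []) j)).length := by
      rw [eval_comp, ← hradx]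
      refine TM2Iter.eval_mono pcB ((hG x).trans (TM2Iter.eval_mono G ?_))
      simp only [length_boolPair, length_stageInput]
      omega
    rw [M.map_kernel_zero x [] j I.n _ hradx (fun c' => ?_) hm, hρ₀]
    · rw [hρ₀] at hρ
      exact (hBn I _ hIn hI hρ).trans ((le_abs_self _).trans (le_add_of_nonneg_right (abs_nonneg _)))
    · obtain ⟨v, hv, -⟩ := hfmt I (θ I.n ^ (3 * I.n) * r) c'
      exact ⟨v, hv⟩
  · -- (STEP₁)
    intro k hk hsm
    obtain ⟨F₁, hF0, hF, hsum⟩ := hstepS k hk hsm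
    refine ⟨F₁, hF0, fun b hb pad j hj => ?_,
      hsum.trans ((le_abs_self _).trans (le_add_of_nonneg_left (abs_nonneg _)))⟩
    rw [M.map_kernel_succ x k _ j I.n fun s hs => (hcodeS k _ j s hs).1]
    exact hF b hb pad j hj
  · -- (PASS₁)
    intro k hk b hb pad j hj
    rw [M.map_kernel_succ x k _ j I.n fun s hs => (hcodeS k _ j s hs).1]
    exact hpassS k hk b hb pad j hj

/-- **Regev 2009, Theorem 3.1 as printed, from Lemma 3.2 and Lemma 3.3 in machine form.**
[cite: Regev2009, Theorem 3.1, Lemmas 3.2, 3.3] -/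
theorem regev2009_thm_3_1_dgs_of_boot_of_step (hB : regev2009_lemma_3_2_sampler)
    (hS : regev2009_lemma_3_3_stepMachine q α) :
    ∀ (m : ℕ → ℕ) (_ : IsPolyBounded m) (_ : IsPolyTimeParams q α m)
      (_ : ∀ᶠ n : ℕ in atTop, 0 < α n ∧ α n < 1 ∧ 2 * Real.sqrt n < α n * q n)
      (_ : ∃ (W : UniformQCircuitFamily) (c : ℝ), 0 < c ∧
        W.SolvesSearchLWEWorstCase q (fun n => discretizedGaussian (q n) (α n)) m
          fun n => (2 : ℝ) ^ (-(c * n)))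
      (ε : ℕ → ℝ), IsNegligible ε → (∀ n, 0 < ε n) →
      ∃ (D : UniformQCircuitFamily) (ν : ℕ → ℝ), IsNegligible ν ∧ D.SamplesDGS (regevDGSBound α ε) ν :=
  regev2009_thm_3_1_dgs_of_oneSampleStage q α (regev2009_thm_3_1_oneSampleStage_of_boot_of_step q α hB hS)

variable (m : ℕ → ℕ)

/-- **Target `pqc.S19` (`regev_lwe_to_sivp_quantum q α m`) from Lemma 3.2 and Lemma 3.3 in machine
form** (with the proved Lemma 3.17). [cite: Regev2009, Theorem 3.1, Lemma 3.17, Theorem 1.1] -/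
theorem regev_lwe_to_sivp_quantum_holds_of_boot_of_step (hB : regev2009_lemma_3_2_sampler)
    (hS : regev2009_lemma_3_3_stepMachine q α) : regev_lwe_to_sivp_quantum q α m :=
  regev_lwe_to_sivp_quantum_holds_of q α m (regev2009_thm_3_1_oneSampleStage_of_boot_of_step q α hB hS)

/-- **`regev_lwe_to_gapSVP_quantum q α m` from Lemma 3.2 and Lemma 3.3 in machine form** (with the
proved Lemma 3.20 machine, `regev2009_lemma_3_20_machine_holds`). [cite: Regev2009, Theorem 3.1,
Lemma 3.20, Theorem 1.1] -/
theorem regev_lwe_to_gapSVP_quantum_holds_of_boot_of_step (hB : regev2009_lemma_3_2_sampler)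
    (hS : regev2009_lemma_3_3_stepMachine q α) : regev_lwe_to_gapSVP_quantum q α m :=
  regev_lwe_to_gapSVP_quantum_holds_of_oneSampleStage q α m
    (regev2009_thm_3_1_oneSampleStage_of_boot_of_step q α hB hS)

end Dispatcher

end Literature.Computability.Cryptography

end
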